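import Summits.ResolutionOfSingularities.ResolutionOfSingularities.Theorems.RadicialJungCleanModelsSufficeGameEndStrata
import Literature.AlgebraicGeometry.Resolution.PthRootPairProportional
import Mathlib.Data.ZMod.Basic

/-!
# Route `RadicialJung`, crux `CleanModelsSuffice`, line `Sketch`: the END STATE of the game —
# the exponents of the charged divisors at neighbouring points are proportional modulo `p`

Helper for the registered stub `stub_gameEndResolves` of the skeleton of
`Summit.ResolutionOfSingularities.ResolutionOfSingularities.Theses.RadicialJung.CleanModelsSuffice`
(stmt-ResolutionOfSingularities-15883). Second consistency statement for gluing the Kummer charts of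
an end state `S` (the first is charge constancy, `…GameEndCharge`): for `w` in the good
neighbourhood of `v` (`S.Near v w`) there is ONE scalar `μ` prime to `p` with

  `a_v(D) ≡ μ · a_w(D) (mod p)` for every exceptional divisor `D` charged at `w`

(`exists_mul_modEq`), where `a_x(D)` is the exponent of the label coordinate of `D` at `x`. For a
single `D` this is the valuation lemma along `D`; that the scalar is common to all `D` is proved on
PAIRS `(D₀, D)`: in the two-dimensional regular local ring at the generic point of the branch of
`D₀ ∩ D` at `v` both presentations `y_v, y_w` are clean in the images of `u_{ℓ₀}, u_ℓ` (a part of a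
regular system of parameters there), so `exists_modEq_pair_of_pth_roots`
(`PthRootPairProportional.lean`) gives one `j` with `(a_w(D₀), a_w(D)) ≡ j (a_v(D₀), a_v(D))`
(`modEq_pair`), and `j ≡ a_w(D₀)/a_v(D₀)` does not depend on `D`.
-/

noncomputable section

set_option linter.dupNamespace false -- mandated namespace of this single-conjunct summit

open CategoryTheory AlgebraicGeometry TopologicalSpace IsLocalRing
open Literature.AlgebraicGeometry.Resolution

namespace Summit.ResolutionOfSingularities.ResolutionOfSingularities.Theorems.RadicialJung.CleanModelsSuffice

attribute [local instance] stalkAlgebra isScalarTower_stalkAlgebra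

namespace GameState

variable {p : ℕ} {V₀ : Scheme.{0}} [IsIntegral V₀] {L : Type} [Field L] [Algebra V₀.functionField L]
  {V : Scheme.{0}} [IsIntegral V] {π : V ⟶ V₀} [IsDominant π] (S : GameState p V₀ L V π)

/-! ## Generators of the stalk of a divisor at a generisation -/

/-- For `ζ ⤳ x` and `D` through `x`, the stalk `I(D)_ζ` is generated by the image of the label
coordinate of `D` at `x`. [folklore] -/
theorem stalkIdeal_eq_span_of_specializes {ζ x : V} (h : ζ ⤳ x)
    (D : {D : V.IdealSheafData // D ∈ S.E ∧ x ∈ D.support}) :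
    stalkIdeal D.1 ζ = Ideal.span {(V.presheaf.stalkSpecializes h).hom (S.u x (S.lab x D))} :=
  stalkIdeal_eq_span_stalkSpecializes h D.1 (S.stalkIdeal_lab x D)

/-- **Two points of `D` under a common generisation see associated images of their label
coordinates of `D`.** [folklore] -/
theorem associated_of_specializes {ζ v w : V} (hv : ζ ⤳ v) (hw : ζ ⤳ w) (D : V.IdealSheafData)
    (hDv : D ∈ S.E ∧ v ∈ D.support) (hDw : D ∈ S.E ∧ w ∈ D.support) :
    Associated ((V.presheaf.stalkSpecializes hv).hom (S.u v (S.lab v ⟨D, hDv⟩)))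
      ((V.presheaf.stalkSpecializes hw).hom (S.u w (S.lab w ⟨D, hDw⟩))) := by
  rw [← Ideal.span_singleton_eq_span_singleton, ← S.stalkIdeal_eq_span_of_specializes hv ⟨D, hDv⟩,
    ← S.stalkIdeal_eq_span_of_specializes hw ⟨D, hDw⟩]

variable [Algebra V.functionField L]

/-! ## The presentation at the generic point of a codimension-two stratum -/

/-- **The presentation at `x` read at a generisation along two divisors.** Let `ζ ⤳ x`, `D₀, D`
through `x` with distinct labels `ℓ₀, ℓ`, the prime of `ζ` in `𝒪_{V,x}` equal to `(u_{ℓ₀}, u_ℓ)`,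
and `s, t ∈ 𝒪_{V,ζ}` associated to the images of `u_{ℓ₀}, u_ℓ`. Then
`y_x^p = E s^{a_x(ℓ₀)} t^{a_x(ℓ)}` in `L` for a unit `E` of `𝒪_{V,ζ}`. [folklore] -/
theorem radicand_pair (H : S.EndHyp) {ζ x : V} (h : ζ ⤳ x)
    (D₀ D : {D : V.IdealSheafData // D ∈ S.E ∧ x ∈ D.support}) (hne : S.lab x D₀ ≠ S.lab x D)
    (hP : primeOfSpecializes h = Ideal.span (Set.range ![S.u x (S.lab x D₀), S.u x (S.lab x D)]))
    (s t : V.presheaf.stalk ζ)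
    (hs : Associated s ((V.presheaf.stalkSpecializes h).hom (S.u x (S.lab x D₀))))
    (ht : Associated t ((V.presheaf.stalkSpecializes h).hom (S.u x (S.lab x D)))) :
    ∃ E : V.presheaf.stalk ζ, IsUnit E ∧ S.y x ^ p =
      algebraMap (V.presheaf.stalk ζ) L (E * s ^ S.a x (S.lab x D₀) * t ^ S.a x (S.lab x D)) := by
  classical
  set ℓ₀ := S.lab x D₀ with hℓ₀
  set ℓ := S.lab x D with hℓ
  set σ := (V.presheaf.stalkSpecializes h).hom with hσ
  have hunit : ∀ i, i ∉ ({ℓ₀, ℓ} : Finset (Fin (S.d x))) → IsUnit (σ (S.u x i)) := by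
    intro i hi
    rw [hσ, isUnit_stalkSpecializes_iff h, hP, range_pair, ← Set.image_pair]
    refine (RoundOff.isRsopPart_u S x).not_mem_span_image (S := {ℓ₀, ℓ}) ?_
    simpa only [Set.mem_insert_iff, Set.mem_singleton_iff, not_or, Finset.mem_insert,
      Finset.mem_singleton] using hi
  obtain ⟨E, hE, hrad⟩ := S.radicand_stalkSpecializes h {ℓ₀, ℓ} hunit
  rw [Finset.prod_pair hne] at hrad
  obtain ⟨u₀, hu₀⟩ := hs
  obtain ⟨u₁, hu₁⟩ := ht
  refine ⟨E * (u₀ : V.presheaf.stalk ζ) ^ S.a x ℓ₀ * (u₁ : V.presheaf.stalk ζ) ^ S.a x ℓ,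
    (hE.mul (u₀.isUnit.pow _)).mul (u₁.isUnit.pow _), ?_⟩
  rw [S.y_pow_stalkSpecializes H h, ← hσ, hrad, ← hu₀, ← hu₁]
  congr 1
  ring

/-- **Pair proportionality.** Let `D₀ ≠ D` be exceptional divisors through `v` and `w`, let `w`
lie under the generic point of the branch of `D₀ ∩ D` at `v`, and let `D₀` be charged at `v`. Then
for one `j < p`: `a_w(D₀) ≡ j a_v(D₀)` and `a_w(D) ≡ j a_v(D) (mod p)`. [folklore] -/
theorem modEq_pair (H : S.EndHyp) {v w : V} (D₀ D : V.IdealSheafData)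
    (hD₀v : D₀ ∈ S.E ∧ v ∈ D₀.support) (hDv : D ∈ S.E ∧ v ∈ D.support)
    (hD₀w : D₀ ∈ S.E ∧ w ∈ D₀.support) (hDw : D ∈ S.E ∧ w ∈ D.support) (hne : D₀ ≠ D)
    (hw : S.genPt₂ v (S.lab_ne (D₀ := ⟨D₀, hD₀v⟩) (D := ⟨D, hDv⟩) hne) ⤳ w)
    (hch : S.chargedAt D₀ v) :
    ∃ j : ℕ, j < p ∧ S.a w (S.lab w ⟨D₀, hD₀w⟩) ≡ j * S.a v (S.lab v ⟨D₀, hD₀v⟩) [MOD p] ∧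
      S.a w (S.lab w ⟨D, hDw⟩) ≡ j * S.a v (S.lab v ⟨D, hDv⟩) [MOD p] := by
  haveI := H.charP
  have hne' : S.lab v ⟨D₀, hD₀v⟩ ≠ S.lab v ⟨D, hDv⟩ := S.lab_ne hne
  have hv := S.genPt₂_specializes v hne'
  set ζ := S.genPt₂ v hne' with hζ
  haveI := S.isRegular ζ
  set σ := (V.presheaf.stalkSpecializes hv).hom with hσ
  set s := σ (S.u v (S.lab v ⟨D₀, hD₀v⟩)) with hs
  set t := σ (S.u v (S.lab v ⟨D, hDv⟩)) with ht
  have hz : IsRsopPart ![s, t] := by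
    have h := S.isRsopPart_genPt₂ v hne'
    have heq : (fun k => (V.presheaf.stalkSpecializes (S.genPt₂_specializes v hne')).hom
        (![S.u v (S.lab v ⟨D₀, hD₀v⟩), S.u v (S.lab v ⟨D, hDv⟩)] k)) = ![s, t] := by
      ext k; fin_cases k <;> rfl
    rwa [heq] at h
  obtain ⟨E₁, hE₁, hyp₁⟩ := S.radicand_pair H hv ⟨D₀, hD₀v⟩ ⟨D, hDv⟩ hne'
    (S.primeOfSpecializes_genPt₂ v hne') s t (Associated.refl _) (Associated.refl _)
  obtain ⟨E₂, hE₂, hyp₂⟩ := S.radicand_pair H hw ⟨D₀, hD₀w⟩ ⟨D, hDw⟩ (S.lab_ne hne)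
    (S.primeOfSpecializes_genPt₂_eq D₀ D hD₀v hDv hD₀w hDw hne hw) s t
    (S.associated_of_specializes hv hw D₀ hD₀v hD₀w) (S.associated_of_specializes hv hw D hDv hDw)
  have ha₁ : ¬ p ∣ S.a v (S.lab v ⟨D₀, hD₀v⟩) := by
    obtain ⟨h0, ha⟩ := (S.chargedAt_iff D₀ v).mp hch
    exact (S.a_spec v _).resolve_left ha
  exact exists_modEq_pair_of_pth_roots (A := V.presheaf.stalk ζ) (K := V.functionField) H.prime
    H.finrank hz E₁ E₂ hE₁ hE₂ _ _ _ _ ha₁ (S.y v) (S.y w) (S.y_not_mem_range H v) hyp₁ hyp₂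

/-! ## One scalar for all charged divisors -/

/-- **The exponents at `v` and at a nearby `w` are proportional modulo `p` with one scalar**: for
`S.Near v w` there is `μ` prime to `p` with `a_v(D) ≡ μ a_w(D) (mod p)` for every exceptional
divisor `D` charged at `w`. [folklore] -/
theorem exists_mul_modEq (H : S.EndHyp) {v w : V} (hn : S.Near v w) :
    ∃ μ : ℕ, ¬ p ∣ μ ∧ ∀ (D : V.IdealSheafData) (hDv : D ∈ S.E ∧ v ∈ D.support)
      (hDw : D ∈ S.E ∧ w ∈ D.support), S.chargedAt D w →
      S.a v (S.lab v ⟨D, hDv⟩) ≡ μ * S.a w (S.lab w ⟨D, hDw⟩) [MOD p] := by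
  classical
  haveI : Fact p.Prime := ⟨H.prime⟩
  by_cases h0 : ∃ D₀, S.chargedAt D₀ w
  · obtain ⟨D₀, hD₀⟩ := h0
    have hD₀E : D₀ ∈ S.E := S.mem_E_of_chargedAt hD₀
    have hwD₀ : w ∈ D₀.support := S.mem_support_of_chargedAt hD₀
    have hvD₀ : v ∈ D₀.support := hn.1 D₀ hD₀E hwD₀
    have hchv : S.chargedAt D₀ v := ((hn.chargedAt_iff S H D₀).mp hD₀).2
    set ev0 := S.a v (S.lab v ⟨D₀, hD₀E, hvD₀⟩) with hev0
    set ew0 := S.a w (S.lab w ⟨D₀, hD₀E, hwD₀⟩) with hew0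
    have hev0p : (ev0 : ZMod p) ≠ 0 := by
      rw [Ne, ZMod.natCast_eq_zero_iff]
      obtain ⟨h1, ha⟩ := (S.chargedAt_iff D₀ v).mp hchv
      exact (S.a_spec v _).resolve_left ha
    have hew0p : (ew0 : ZMod p) ≠ 0 := by
      rw [Ne, ZMod.natCast_eq_zero_iff]
      obtain ⟨h1, ha⟩ := (S.chargedAt_iff D₀ w).mp hD₀
      exact (S.a_spec w _).resolve_left ha
    set μz : ZMod p := (ev0 : ZMod p) * (ew0 : ZMod p)⁻¹ with hμz
    have hμz0 : μz ≠ 0 := mul_ne_zero hev0p (inv_ne_zero hew0p)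
    refine ⟨μz.val, ?_, ?_⟩
    · rw [← ZMod.natCast_eq_zero_iff, ZMod.natCast_zmod_val]
      exact hμz0
    · intro D hDv hDw hchw
      rw [← ZMod.natCast_eq_natCast_iff]
      push_cast
      rw [ZMod.natCast_zmod_val]
      by_cases hDD : D = D₀
      · subst hDD
        change (ev0 : ZMod p) = μz * ew0
        rw [hμz, mul_assoc, inv_mul_cancel₀ hew0p, mul_one]
      · obtain ⟨j, -, h1, h2⟩ := S.modEq_pair H D₀ D ⟨hD₀E, hvD₀⟩ hDv ⟨hD₀E, hwD₀⟩ hDw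
          (Ne.symm hDD) (hn.2.2 D₀ D _ _ (Ne.symm hDD) hwD₀ hDw.2) hchv
        rw [← ZMod.natCast_eq_natCast_iff] at h1 h2
        push_cast at h1 h2
        change (ew0 : ZMod p) = j * ev0 at h1
        have hj0 : (j : ZMod p) ≠ 0 := by
          intro hj
          rw [hj, zero_mul] at h1
          exact hew0p h1
        rw [h2, hμz, h1]
        field_simp
  · push Not at h0
    exact ⟨1, fun h => H.prime.one_lt.ne' (Nat.eq_one_of_dvd_one h), fun D _ _ hch => absurd hch (h0 D)⟩

end GameState

/-- Proportionality of the exponents at neighbouring points of an end state (explicit-binder form,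
the registered interface of this helper file). [folklore] -/
theorem gameState_exists_mul_modEq {p : ℕ} {V₀ : Scheme.{0}} [IsIntegral V₀] {L : Type} [Field L]
    [Algebra V₀.functionField L] {V : Scheme.{0}} [IsIntegral V] {π : V ⟶ V₀} [IsDominant π]
    (S : GameState p V₀ L V π) [Algebra V.functionField L] (H : S.EndHyp) {v w : V} (hn : S.Near v w) :
    ∃ μ : ℕ, ¬ p ∣ μ ∧ ∀ (D : V.IdealSheafData) (hDv : D ∈ S.E ∧ v ∈ D.support)
      (hDw : D ∈ S.E ∧ w ∈ D.support), S.chargedAt D w →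
      S.a v (S.lab v ⟨D, hDv⟩) ≡ μ * S.a w (S.lab w ⟨D, hDw⟩) [MOD p] :=
  S.exists_mul_modEq H hn

end Summit.ResolutionOfSingularities.ResolutionOfSingularities.Theorems.RadicialJung.CleanModelsSuffice

end
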